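import Literature.Barriers.MatrixMultiplication.QuasirandomBarrierGLn
import HarnessLib

/-!
# BCGPU 2023, §1.1: subgroup TPP triples inside PRODUCTS of groups `GL(n,q)` (fixed `n`) cannot meet the packing bound — proved

Topic `Literature/Barriers/MatrixMultiplication` (D-0021 barrier catalogue for the summit
`MatrixMultiplication`); proof file attached to the catalogue entry `NormalizerBarrier.lean`
(Blasiak–Cohn–Grochow–Pratt–Umans 2023, Thm. 3.6 / Cor. 3.8) and sequel to
`QuasirandomBarrierGLn.lean`, whose module docstring lists "direct powers `GL(n, q)^m`" under
"WHAT THIS IS NOT".  Everything here is **proved**; no definition, no named fact.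

Source, verbatim (J. Blasiak, H. Cohn, J. A. Grochow, K. Pratt, C. Umans, *Matrix multiplication via
matrix groups*, ITCS 2023, arXiv:2204.03826 [BlasiakCohnGrochowPrattUmans2023], §1.1, p. 4 of the
held text `paper:arxiv-2204.03826`):

> "Next we show in Theorem 3.6 that subgroups with large normalizers cannot be used in a triple
> product property construction to obtain `ω = 2`. This barrier is particularly effective in the
> setting of matrix groups. For example, one cannot obtain `ω = 2` via a triple product property
> construction using three subgroups inside `GL(n,q)` for varying `q` and any fixed `n`, or even
> inside products of such groups."

and §3.2, p. 7: "The following corollary shows that triple product property constructions using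
subgroups of groups `G` satisfying `|Z(G)| = Ω(|G|^δ)` with `δ>0` cannot meet the packing bound. …
Corollary 3.8. If subgroups `H₁`, `H₂`, and `H₃` satisfy the triple product property in a finite group
`G`, then `|H₁||H₂||H₃| ≤ |G|^{3/2}/|Z(G)|^{1/2}`."

## Content

The single-factor sentence ("three subgroups inside `GL(n,q)`") is the tree's
`SubgroupTPP.card_mul_le_GL` (`QuasirandomBarrierGLn.lean`).  Here: the clause **"or even inside
products of such groups"**.  For a finite product `G = ∏ᵢ GL_n(Fᵢ)` (`n = m + 1 ≥ 1`, finite fields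
`Fᵢ` with `qᵢ = |Fᵢ| ≥ 3`):

* `natCard_center_pi` — `|Z(∏ᵢ Gᵢ)| = ∏ᵢ |Z(Gᵢ)|` (Mathlib's `Subgroup.center_pi`), whence
  `|Z(G)| = ∏ᵢ (qᵢ − 1)` (`natCard_center_GL_pi`, with the tree's `GLn.natCard_center`);
* `card_GL_pi_rpow_le_natCard_center` — `|G|^{1/(2n²)} ≤ |Z(G)|`
  (`|G| ≤ (∏ qᵢ)^{n²}` and `√q ≤ q − 1` for `q ≥ 3`), i.e. "`|Z(G)| = Ω(|G|^δ)`" with `δ = 1/(2n²)`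
  UNIFORMLY in the number of factors and in the `qᵢ ≥ 3`;
* **`SubgroupTPP.card_mul_le_GL_pi`** — every triple of subgroups `H₁, H₂, H₃ ≤ ∏ᵢ GL_n(Fᵢ)` with
  the triple product property has `|H₁||H₂||H₃| ≤ |G|^{3/2 − 1/(4n²)}` (Cor. 3.8 in the tree's
  `|G|^δ` form `SubgroupTPP.center_barrier_rpow`), and the equal-field power
  `SubgroupTPP.card_mul_le_GL_pow` (`GL_n(F)^k`, any `k`): for `n` fixed these triples stay a factor
  `|G|^{1/(4n²)}` below the packing bound `|G|^{3/2 − o(1)}` (Def. 2.3), whatever the number of factors.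

Fields with `q = 2` are excluded from the hypothesis: `GL(n,2) = SL(n,2)` has trivial centre, so
Cor. 3.8 says nothing about factors `GL(n,2)`; powers of the FIXED group `GL(n,2)` are covered instead
by Sawin's theorem (the tree's `Sawin2018_thm15_stpp`), in the CKSU-(2.2) reading.

WHAT THIS IS NOT: nothing about arbitrary SUBSETS of `∏ GL_n(Fᵢ)` (Thm. 3.2 saves only
`√n(GL_n(q)) = |G|^{O(1/k)}` in a `k`-fold product — the direct-product escape of §1.1, tree
`tpp_card_le_pow`), nothing about `ω`.
-/

noncomputable section

open scoped BigOperators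
open Matrix

namespace Literature.Barriers.MatrixMultiplication

/-! ## §1 The centre of a finite product -/

section CentrePi

variable {ι : Type} [Fintype ι] {G : ι → Type} [∀ i, Group (G i)]

/-- `|Z(∏ᵢ Gᵢ)| = ∏ᵢ |Z(Gᵢ)|` ("the direct product … the centre is the product of the centres";
Mathlib's `Subgroup.center_pi`). [folklore] -/
private theorem natCard_center_pi :
    Nat.card (Subgroup.center (∀ i, G i)) = ∏ i, Nat.card (Subgroup.center (G i)) := by
  rw [Subgroup.center_pi, ← Nat.card_pi]
  refine Nat.card_congr
    { toFun := fun f i => ⟨(f : ∀ i, G i) i, (Subgroup.mem_pi _).1 f.2 i (Set.mem_univ i)⟩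
      invFun := fun g => ⟨fun i => (g i : G i), (Subgroup.mem_pi _).2 fun i _ => (g i).2⟩
      left_inv := fun f => rfl
      right_inv := fun g => rfl }

end CentrePi

/-! ## §2 Products of `GL_n(Fᵢ)`: the centre is `∏ (qᵢ − 1) ≥ |G|^{1/(2n²)}` -/

section GLProducts

variable {ι : Type} [Fintype ι] {F : ι → Type} [∀ i, Field (F i)] [∀ i, Fintype (F i)]
  [∀ i, DecidableEq (F i)] {m : ℕ}

omit [∀ i, DecidableEq (F i)] in
/-- `|Z(∏ᵢ GL_{m+1}(Fᵢ))| = ∏ᵢ (qᵢ − 1)`. [cite: BlasiakCohnGrochowPrattUmans2023, §1.1 (p. 4) and §3.2 (before Cor. 3.8)] -/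
theorem natCard_center_GL_pi :
    Nat.card (Subgroup.center (∀ i, GL (Fin (m + 1)) (F i))) = ∏ i, (Fintype.card (F i) - 1) := by
  rw [natCard_center_pi]
  exact Finset.prod_congr rfl fun i _ => GLn.natCard_center

/-- `|∏ᵢ GL_{m+1}(Fᵢ)| ≤ (∏ᵢ qᵢ)^{(m+1)²}`. [folklore] -/
private theorem natCard_GL_pi_le :
    Nat.card (∀ i, GL (Fin (m + 1)) (F i)) ≤ (∏ i, Fintype.card (F i)) ^ ((m + 1) * (m + 1)) := by
  rw [Nat.card_pi, ← Finset.prod_pow]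
  refine Finset.prod_le_prod' fun i _ => ?_
  rw [Nat.card_eq_fintype_card]
  exact GLn.card_le_pow

/-- `√q ≤ q − 1` for `q ≥ 3`. [folklore] -/
private theorem sqrt_le_sub_one {q : ℕ} (hq : 3 ≤ q) : Real.sqrt q ≤ ((q - 1 : ℕ) : ℝ) := by
  have hq' : (3 : ℝ) ≤ q := by exact_mod_cast hq
  rw [Nat.cast_sub (by omega : 1 ≤ q), Nat.cast_one, Real.sqrt_le_iff]
  constructor
  · linarith
  · nlinarith

/-- **"`|Z(G)| = Ω(|G|^δ)`" for products of `GL_n`, uniformly in the number of factors**: for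
`G = ∏ᵢ GL_{m+1}(Fᵢ)` with all `qᵢ ≥ 3`, `|G|^{1/(2(m+1)²)} ≤ |Z(G)|`
(`|G| ≤ (∏ qᵢ)^{(m+1)²}`, `(∏ qᵢ)^{1/2} = ∏ √qᵢ ≤ ∏ (qᵢ − 1) = |Z(G)|`).
[cite: BlasiakCohnGrochowPrattUmans2023, §1.1 (p. 4) and §3.2 (before Cor. 3.8)] -/
theorem card_GL_pi_rpow_le_natCard_center (hq : ∀ i, 3 ≤ Fintype.card (F i)) :
    (Nat.card (∀ i, GL (Fin (m + 1)) (F i)) : ℝ) ^ (1 / (2 * ((m + 1) * (m + 1) : ℕ)) : ℝ) ≤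
      Nat.card (Subgroup.center (∀ i, GL (Fin (m + 1)) (F i))) := by
  set P : ℕ := ∏ i, Fintype.card (F i) with hP
  set d : ℕ := (m + 1) * (m + 1) with hd
  have hd0 : (0 : ℝ) < (d : ℝ) := by rw [hd]; positivity
  have hP0 : (0 : ℝ) ≤ (P : ℝ) := Nat.cast_nonneg _
  have hG0 : (0 : ℝ) ≤ (Nat.card (∀ i, GL (Fin (m + 1)) (F i)) : ℝ) := Nat.cast_nonneg _
  -- `|G| ≤ P^d`
  have hG : (Nat.card (∀ i, GL (Fin (m + 1)) (F i)) : ℝ) ≤ (P : ℝ) ^ (d : ℝ) := by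
    rw [Real.rpow_natCast]
    exact_mod_cast natCard_GL_pi_le (F := F) (m := m)
  -- `|G|^{1/(2d)} ≤ (P^d)^{1/(2d)} = P^{1/2} = √P`
  have h1 : (Nat.card (∀ i, GL (Fin (m + 1)) (F i)) : ℝ) ^ (1 / (2 * (d : ℕ)) : ℝ) ≤ Real.sqrt P := by
    calc (Nat.card (∀ i, GL (Fin (m + 1)) (F i)) : ℝ) ^ (1 / (2 * (d : ℕ)) : ℝ)
        ≤ ((P : ℝ) ^ (d : ℝ)) ^ (1 / (2 * (d : ℕ)) : ℝ) :=
          Real.rpow_le_rpow hG0 hG (by positivity)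
      _ = Real.sqrt P := by
          rw [← Real.rpow_mul hP0, Real.sqrt_eq_rpow]
          congr 1
          field_simp
  -- `√P = ∏ √qᵢ ≤ ∏ (qᵢ − 1) = |Z(G)|`
  have h2 : Real.sqrt P ≤ ((∏ i, (Fintype.card (F i) - 1) : ℕ) : ℝ) := by
    rw [hP, Nat.cast_prod, Nat.cast_prod, Real.sqrt_eq_rpow, ← Real.finsetProd_rpow _ _
      (fun i _ => Nat.cast_nonneg _)]
    refine Finset.prod_le_prod (fun i _ => Real.rpow_nonneg (Nat.cast_nonneg _) _) fun i _ => ?_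
    rw [← Real.sqrt_eq_rpow]
    exact sqrt_le_sub_one (hq i)
  rw [natCard_center_GL_pi]
  exact h1.trans h2

/-- **BCGPU 2023, §1.1: "one cannot obtain `ω = 2` via a triple product property construction using
three subgroups inside `GL(n,q)` for varying `q` and any fixed `n`, or even inside products of such
groups"** — the products clause, effective: for every finite product `G = ∏ᵢ GL_n(Fᵢ)`
(`n = m + 1`, all `qᵢ = |Fᵢ| ≥ 3`, any number of factors) and subgroups `H₁, H₂, H₃ ≤ G` with the
triple product property, `|H₁||H₂||H₃| ≤ |G|^{3/2 − 1/(4n²)}` — a fixed power of `|G|` below the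
packing bound `|G|^{3/2 − o(1)}` which `ω = 2` via Thm. 2.2 requires (§2). Proof: Cor. 3.8 in the
`|G|^δ` form (tree `SubgroupTPP.center_barrier_rpow`) with `|Z(G)| = ∏ (qᵢ − 1) ≥ |G|^{1/(2n²)}`.
(Factors with `q = 2` have trivial centre and are excluded; see the module docstring.)
[cite: BlasiakCohnGrochowPrattUmans2023, §1.1 (p. 4) and Cor. 3.8] -/
theorem SubgroupTPP.card_mul_le_GL_pi (hq : ∀ i, 3 ≤ Fintype.card (F i))
    {H₁ H₂ H₃ : Subgroup (∀ i, GL (Fin (m + 1)) (F i))} (h : SubgroupTPP H₁ H₂ H₃) :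
    ((Nat.card H₁ * Nat.card H₂ * Nat.card H₃ : ℕ) : ℝ) ≤
      (Nat.card (∀ i, GL (Fin (m + 1)) (F i)) : ℝ) ^
        (3 / 2 - 1 / (4 * ((m + 1) * (m + 1) : ℕ)) : ℝ) := by
  have h' := h.center_barrier_rpow (card_GL_pi_rpow_le_natCard_center hq)
  convert h' using 2
  push_cast
  field_simp
  ring

end GLProducts

/-! ## §3 Equal factors: the powers `GL_n(F)^k` -/

section GLPowers

variable {F : Type} [Field F] [Fintype F] [DecidableEq F] {m : ℕ}

/-- **Powers `GL_n(F)^k`** (`n = m + 1`, `q = |F| ≥ 3`, any `k`): subgroups `H₁, H₂, H₃ ≤ GL_n(F)^k`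
with the triple product property have `|H₁||H₂||H₃| ≤ |GL_n(F)^k|^{3/2 − 1/(4n²)}`, uniformly in `k`
and `q` — "or even inside products of such groups".
[cite: BlasiakCohnGrochowPrattUmans2023, §1.1 (p. 4) and Cor. 3.8] -/
theorem SubgroupTPP.card_mul_le_GL_pow (hq : 3 ≤ Fintype.card F) (k : ℕ)
    {H₁ H₂ H₃ : Subgroup (Fin k → GL (Fin (m + 1)) F)} (h : SubgroupTPP H₁ H₂ H₃) :
    ((Nat.card H₁ * Nat.card H₂ * Nat.card H₃ : ℕ) : ℝ) ≤
      (Nat.card (Fin k → GL (Fin (m + 1)) F) : ℝ) ^ (3 / 2 - 1 / (4 * ((m + 1) * (m + 1) : ℕ)) : ℝ) :=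
  SubgroupTPP.card_mul_le_GL_pi (F := fun _ : Fin k => F) (fun _ => hq) h

end GLPowers

end Literature.Barriers.MatrixMultiplication

end
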